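import Summits.CriticalPhenomena.PercolationContinuityZ3.Theorems.PercNearOneGluingNoHeavyLowerTailApexTwoSumFanPieces
import Summits.CriticalPhenomena.PercolationContinuityZ3.Theorems.PercNearOneGluingNoHeavyLowerTailThreeSumAtoms
import HarnessLib

/-!
# `NoHeavyLowerTail` (stmt-CriticalPhenomena-4575) — 2-sums through the apex, part 10:
# R1-RC ON WHEELS WITH THE HUB AS APEX, every `q ≥ 1` (kernel)

Support file (prover prim-gen-kcluster gen 72; `--supports stmt-CriticalPhenomena-4575`).  No definitions, no named
facts, no sorries.

THE WHEEL with hub `a` over the rim cycle `b, arc₁, c, arc₂` (back to `b`): spokes from `a` to every rim vertex and the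
rim pairs of the cycle.  Cutting at the terminal triple `{a, b, c}` gives the two FAN PIECES of part 9,
`FP(a; b :: arc₁, c)` (spokes to `b` and `arc₁`, rim from `b` through `arc₁` to `c`) and `FP(a; c :: arc₂, b)`; the wheel's
support is their union (this is how the support `D` is given in the statement: `e ∈ D ↔ e ∈ FP(a; b :: arc₁, c) ∨
e ∈ FP(a; c :: arc₂, b)`).

**THEOREM** (`ApexTwoSum.wheel_r1`).  For `q ≥ 1`, a rim cycle `b :: arc₁ ++ c :: arc₂` of distinct vertices avoiding the
hub `a` with the first arc non-empty (if both arcs are empty the rim degenerates to the double pair `bc`; if only `arc₂` is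
empty the terminals are adjacent on the rim and R1 is anyway trivial, `r1_of_adjacent`), and parameters positive on the
wheel and zero off it, the free random-cluster measure satisfies R1 for
`(a; b, c)`: `φ(b, c ∈ C(a)) · φ(b, c ∉ C(a), C(a) meets every b–c path) ≤ φ(b ∈ C(a), c ∉ C(a)) · φ(c ∈ C(a), b ∉ C(a))`.
PROOF: the two fan pieces satisfy R1 (`fanPiece_r1`, part 9) and R1 is closed under 3-sums along `{a, b, c}` for `q ≥ 1`
(`ThreeSum.r1_of_threeSum_of_r1`, gen 71).  This is KCLUSTER-gen69 §6.3 ("R1-RC(q ≥ 1) on every wheel, hub apex") as a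
kernel theorem — the first 3-connected family beyond `K_{3,n}`.
-/

noncomputable section

namespace Summit.CriticalPhenomena.PercolationContinuityZ3.Theorems

namespace ApexTwoSum

open Finset SimpleGraph Literature.Probability.Percolation Literature.Probability.Percolation.Gladkov
open Literature.Probability.Percolation.BHK2006 (weight)
open Literature.Probability.Percolation.DecisionTree (ind ind_of_mem ind_of_not_mem ind_nonneg)
open Literature.Probability.LatticeModels RefinedRowR3 ThreePointLB MeasureTheory
open scoped Classical

variable {V : Type*} [Fintype V]

omit [Fintype V] in
/-- Every pair of a fan piece contains a list vertex. [this work] -/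
theorem exists_mem_fanPiece (a c : V) : ∀ (L : List V), ∀ e ∈ (List.toFinset (List.map (fun y => s(a, y)) L ++ List.zipWith (fun y y' => s(y, y')) (L ++ [c]) (List.tail (L ++ [c])))), ∃ t ∈ L, t ∈ e := by
  intro L
  induction L with
  | nil =>
    intro e he
    simp only [List.map_nil, List.nil_append, List.tail_cons, List.zipWith_nil_right, List.append_nil,
      List.toFinset_nil, Finset.notMem_empty] at he
  | cons y r ih =>
    cases r with
    | nil =>
      intro e he
      rcases (mem_fanPiece_single a).1 he with rfl | rfl
      · exact ⟨y, List.mem_cons_self, Sym2.mem_mk_right a y⟩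
      · exact ⟨y, List.mem_cons_self, Sym2.mem_mk_left y c⟩
    | cons y' r' =>
      intro e he
      rcases (mem_fanPiece_cons_cons a).1 he with (rfl | rfl) | he'
      · exact ⟨y, List.mem_cons_self, Sym2.mem_mk_right a y⟩
      · exact ⟨y, List.mem_cons_self, Sym2.mem_mk_left y y'⟩
      · obtain ⟨t, ht, hte⟩ := ih e he'
        exact ⟨t, List.mem_cons_of_mem _ ht, hte⟩

section Wheels

variable (a : V) {q : ℝ} (hq : 1 ≤ q)
include hq

/-- **R1-RC on wheels with the hub as apex, every `q ≥ 1`** (see the module docstring). [this work] -/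
theorem wheel_r1 (arc₁ arc₂ : List V) (b c : V) (D : Finset (Sym2 V)) (w : Sym2 V → unitInterval)
    (h₁ : arc₁ ≠ []) (hnd : (b :: (arc₁ ++ c :: arc₂)).Nodup) (hal : a ∉ b :: (arc₁ ++ c :: arc₂))
    (hD : ∀ e, e ∈ D ↔ e ∈ (List.toFinset (List.map (fun y => s(a, y)) (b :: arc₁) ++ List.zipWith (fun y y' => s(y, y')) ((b :: arc₁) ++ [c]) (List.tail ((b :: arc₁) ++ [c])))) ∨ e ∈ (List.toFinset (List.map (fun y => s(a, y)) (c :: arc₂) ++ List.zipWith (fun y y' => s(y, y')) ((c :: arc₂) ++ [b]) (List.tail ((c :: arc₂) ++ [b])))))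
    (hpos : ∀ e ∈ D, 0 < (w e : ℝ)) (hoff : ∀ e, e ∉ (↑D : Set (Sym2 V)) → (w e : ℝ) = 0) :
    (rcMeasureW w q ∅).real {η : BondConfig V | b ∈ cl η.toFinset a ∧ c ∈ cl η.toFinset a} *
        (rcMeasureW w q ∅).real {η : BondConfig V | b ∉ cl η.toFinset a ∧ c ∉ cl η.toFinset a ∧
          Sep D (cl η.toFinset a) b c} ≤
      (rcMeasureW w q ∅).real {η : BondConfig V | b ∈ cl η.toFinset a ∧ c ∉ cl η.toFinset a} *
        (rcMeasureW w q ∅).real {η : BondConfig V | b ∉ cl η.toFinset a ∧ c ∈ cl η.toFinset a} := by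
  have hq0 : 0 < q := one_pos.trans_le hq
  -- distinctness facts
  have hb : b ∉ arc₁ ++ c :: arc₂ := (List.nodup_cons.1 hnd).1
  have hnd₁ : (arc₁ ++ c :: arc₂).Nodup := (List.nodup_cons.1 hnd).2
  have hbc : b ≠ c := fun h => hb (List.mem_append.2 (Or.inr (by rw [h]; exact List.mem_cons_self)))
  have hab : a ≠ b := fun h => hal (by rw [h]; exact List.mem_cons_self)
  have hcmem : c ∈ b :: (arc₁ ++ c :: arc₂) := List.mem_cons_of_mem _ (List.mem_append.2 (Or.inr List.mem_cons_self))
  have hac : a ≠ c := fun h => hal (by rw [h]; exact hcmem)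
  have hcarc₂ : (c :: arc₂).Nodup := List.Nodup.sublist (List.sublist_append_right arc₁ (c :: arc₂)) hnd₁
  have hc₂ : c ∉ arc₂ := (List.nodup_cons.1 hcarc₂).1
  have harc₁ : arc₁.Nodup := List.Nodup.sublist (List.sublist_append_left arc₁ (c :: arc₂)) hnd₁
  have hdisj₁₂ : ∀ v, v ∈ arc₁ → v ∈ c :: arc₂ → False := fun v hv hv' =>
    List.disjoint_of_nodup_append hnd₁ hv hv'
  -- the rim lists of the two pieces
  have hndA : (b :: (arc₁ ++ [c])).Nodup := by
    refine List.Nodup.sublist (List.Sublist.cons_cons b (List.Sublist.append_left ?_ arc₁)) hnd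
    exact List.singleton_sublist.2 List.mem_cons_self
  have halA : a ∉ b :: (arc₁ ++ [c]) := by
    intro h
    rcases List.mem_cons.1 h with h | h
    · exact hab h
    rcases List.mem_append.1 h with h | h
    · exact hal (List.mem_cons_of_mem _ (List.mem_append.2 (Or.inl h)))
    · exact hac (List.mem_singleton.1 h)
  have hndB : (c :: (arc₂ ++ [b])).Nodup := by
    have h1 : (b :: c :: arc₂).Nodup :=
      List.Nodup.sublist (List.Sublist.cons_cons b (List.sublist_append_right arc₁ (c :: arc₂))) hnd
    have h2 : List.Perm ((c :: arc₂) ++ [b]) (b :: (c :: arc₂ ++ [])) := List.perm_middle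
    rw [List.append_nil] at h2
    exact h2.nodup_iff.2 h1
  have halB : a ∉ c :: (arc₂ ++ [b]) := by
    intro h
    rcases List.mem_cons.1 h with h | h
    · exact hac h
    rcases List.mem_append.1 h with h | h
    · exact hal (List.mem_cons_of_mem _ (List.mem_append.2 (Or.inr (List.mem_cons_of_mem _ h))))
    · exact hab (List.mem_singleton.1 h)
  -- the two pieces
  set DA : Finset (Sym2 V) := (List.toFinset (List.map (fun y => s(a, y)) (b :: arc₁) ++ List.zipWith (fun y y' => s(y, y')) ((b :: arc₁) ++ [c]) (List.tail ((b :: arc₁) ++ [c])))) with hDA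
  set DB : Finset (Sym2 V) := (List.toFinset (List.map (fun y => s(a, y)) (c :: arc₂) ++ List.zipWith (fun y y' => s(y, y')) ((c :: arc₂) ++ [b]) (List.tail ((c :: arc₂) ++ [b])))) with hDB
  have vertsA := verts_fanPiece a c (b :: arc₁)
  have vertsB := verts_fanPiece a b (c :: arc₂)
  have hsepD : ∀ v : V, (∃ e ∈ DA, v ∈ e) → (∃ e ∈ DB, v ∈ e) → (v = a ∨ v = b ∨ v = c) := by
    rintro v ⟨e, he, hve⟩ ⟨e', he', hve'⟩
    rcases vertsA e he v hve with h1 | h1 | h1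
    · exact Or.inl h1
    · rcases List.mem_cons.1 h1 with h1 | h1
      · exact Or.inr (Or.inl h1)
      · rcases vertsB e' he' v hve' with h3 | h3 | h3
        · exact Or.inl h3
        · exact absurd h3 (fun h3 => hdisj₁₂ v h1 h3)
        · exact Or.inr (Or.inl h3)
    · exact Or.inr (Or.inr h1)
  -- the pieces are disjoint (both arcs are non-empty)
  have hdisj : ∀ e ∈ DB, e ∉ DA := by
    intro e heB heA
    obtain ⟨t, ht, hte⟩ := exists_mem_fanPiece a b (c :: arc₂) e heB
    obtain ⟨t', ht', ht'e⟩ := exists_mem_fanPiece a c (b :: arc₁) e heA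
    -- `t = c` and `t' = b`
    have htc : t = c := by
      rcases vertsA e heA t hte with h1 | h1 | h1
      · have h2 : t ∈ b :: (arc₁ ++ c :: arc₂) := List.mem_cons_of_mem _ (List.mem_append.2 (Or.inr ht))
        rw [h1] at h2; exact absurd h2 hal
      · rcases List.mem_cons.1 h1 with h1 | h1
        · rw [h1] at ht; exact absurd (List.mem_append.2 (Or.inr ht)) hb
        · exact (hdisj₁₂ t h1 ht).elim
      · exact h1
    have htb : t' = b := by
      rcases vertsB e heB t' ht'e with h1 | h1 | h1
      · have h2 : t' ∈ b :: (arc₁ ++ c :: arc₂) := by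
          rcases List.mem_cons.1 ht' with h4 | h4
          · rw [h4]; exact List.mem_cons_self
          · exact List.mem_cons_of_mem _ (List.mem_append.2 (Or.inl h4))
        rw [h1] at h2; exact absurd h2 hal
      · rcases List.mem_cons.1 ht' with h4 | h4
        · exact h4
        · exact (hdisj₁₂ t' h4 h1).elim
      · exact h1
    rw [htc] at hte; rw [htb] at ht'e
    have he : e = s(b, c) := (Sym2.mem_and_mem_iff hbc).1 ⟨ht'e, hte⟩
    -- but `s(b, c)` is not a pair of `FP(a; b :: arc₁, c)` when `arc₁ ≠ []`
    obtain ⟨y, r, hyr⟩ := List.exists_cons_of_ne_nil h₁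
    have heA' : s(b, c) ∈ (List.toFinset (List.map (fun y => s(a, y)) (b :: y :: r) ++ List.zipWith (fun y y' => s(y, y')) ((b :: y :: r) ++ [c]) (List.tail ((b :: y :: r) ++ [c])))) := by rw [← hyr, ← he]; exact heA
    rw [hyr] at hdisj₁₂ hb
    rcases (mem_fanPiece_cons_cons a).1 heA' with (h5 | h5) | h5
    · have ha : a ∈ s(b, c) := by rw [h5]; exact Sym2.mem_mk_left a b
      rcases Sym2.mem_iff.1 ha with h6 | h6
      · exact hab h6
      · exact hac h6
    · have hy : y ∈ s(b, c) := by rw [h5]; exact Sym2.mem_mk_right b y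
      rcases Sym2.mem_iff.1 hy with h6 | h6
      · exact hb (List.mem_append.2 (Or.inl (by rw [← h6]; exact List.mem_cons_self)))
      · exact hdisj₁₂ c (by rw [← h6]; exact List.mem_cons_self) List.mem_cons_self
    · rcases verts_fanPiece a c (y :: r) _ h5 b (Sym2.mem_mk_left b c) with h6 | h6 | h6
      · exact hab h6.symm
      · exact hb (List.mem_append.2 (Or.inl h6))
      · exact hbc h6
  -- the piece parameters
  set wA : Sym2 V → unitInterval := fun e => if e ∈ (↑DA : Set (Sym2 V)) then w e else 0 with hwA
  set wB : Sym2 V → unitInterval := fun e => if e ∈ (↑DA : Set (Sym2 V)) then 0 else w e with hwB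
  have hA : ∀ e ∈ (↑DA : Set (Sym2 V)), wA e = w e := fun e he => by simp only [hwA, if_pos he]
  have hA' : ∀ e ∉ (↑DA : Set (Sym2 V)), wA e = 0 := fun e he => by simp only [hwA, if_neg he]
  have hB : ∀ e ∈ (↑DA : Set (Sym2 V)), wB e = 0 := fun e he => by simp only [hwB, if_pos he]
  have hB' : ∀ e ∉ (↑DA : Set (Sym2 V)), wB e = w e := fun e he => by simp only [hwB, if_neg he]
  have hw : ∀ e, e ∉ (↑DA ∪ ↑DB : Set (Sym2 V)) → (w e : ℝ) = 0 := fun e he =>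
    hoff e (fun he' => he (by
      rw [Finset.mem_coe] at he'
      rcases (hD e).1 he' with h1 | h1
      · exact Or.inl h1
      · exact Or.inr h1))
  have hposA : ∀ e ∈ DA, 0 < (wA e : ℝ) := fun e he => by
    rw [hA e (Finset.mem_coe.2 he)]
    exact hpos e ((hD e).2 (Or.inl he))
  have hoffA : ∀ e, e ∉ (↑DA : Set (Sym2 V)) → (wA e : ℝ) = 0 := fun e he => by rw [hA' e he]; rfl
  have hposB : ∀ e ∈ DB, 0 < (wB e : ℝ) := fun e he => by
    rw [hB' e (fun he' => hdisj e he (Finset.mem_coe.1 he'))]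
    exact hpos e ((hD e).2 (Or.inr he))
  have hoffB : ∀ e, e ∉ (↑DB : Set (Sym2 V)) → (wB e : ℝ) = 0 := fun e he => by
    by_cases heA : e ∈ (↑DA : Set (Sym2 V))
    · rw [hB e heA]; rfl
    · rw [hB' e heA]
      exact hoff e (fun he' => by
        rw [Finset.mem_coe] at he'
        rcases (hD e).1 he' with h1 | h1
        · exact heA (Finset.mem_coe.2 h1)
        · exact he (Finset.mem_coe.2 h1))
  -- R1 on the pieces
  have hR1A := fanPiece_r1 a hq arc₁ b c wA hndA halA hposA hoffA
  have hR1B' := fanPiece_r1 a hq arc₂ c b wB hndB halB hposB hoffB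
  have hR1B := r1_symm (a := a) wB q DB hR1B'
  -- the 3-sum
  exact ThreeSum.r1_of_threeSum_of_r1 hab hac hbc hsepD hD w wA wB hq hw hA hA' hB hB' hR1A hR1B

end Wheels

end ApexTwoSum

end Summit.CriticalPhenomena.PercolationContinuityZ3.Theorems
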